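import Summits.BirchSwinnertonDyer.BirchSwinnertonDyer.Theorems.SchneiderFreeAdditiveX3PotMultBranchIMCTargetCurrency
import Summits.BirchSwinnertonDyer.BirchSwinnertonDyer.Theorems.SchneiderFreeAdditiveX3HeegnerTwistData
import Summits.BirchSwinnertonDyer.BirchSwinnertonDyer.Theorems.SchneiderFreeAdditiveX3JointLowerManin
import Summits.BirchSwinnertonDyer.BirchSwinnertonDyer.Theorems.SchneiderFreeAdditiveX3PartnerUpperRankZero
import Summits.BirchSwinnertonDyer.BirchSwinnertonDyer.Theorems.SchneiderFreeAdditiveX3HeegnerTwistEqualities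
import Summits.BirchSwinnertonDyer.Rank1Residual.Additive.N10LowerHalfStatements
import HarnessLib

/-!
# Route `SchneiderFreeAdditiveX3` (rung K1 door), crux `PotMultBranchIMC` (item stmt-BirchSwinnertonDyer-19176):
# STRENGTH PLACEMENT — modulo control and print, the crux sits between the rung leaf on (M) and
# «leaf on (M) ∧ the partner's rank-zero lower half»

Cell `bsd-schneider-ideate`, seat `bsd-schneider-door-c2` (prover, generation 3). HONEST FRAMING:
arithmetic bookkeeping on the route's own sockets and the tree's typed currency; NOTHING is asserted
about elliptic curves; the crux `PotMultBranchIMC` (the door-direction branch main conjecture on the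
potentially multiplicative reducible cell — NOT in print, door-c2 g0/g2), the control crux
`AnticycControlAdditiveK` and the tree conjecture `Additive.N10.LowerHalfM` stay OPEN; BSD is not
advanced by this file; it is `--supports` material for item 19176 (the tribunal's «C versus S» datum
in kernel form, completing g2's `potMultBranchIMC_iff_stepL_subM_of_kolyvagin_of_control`).

## What is kernel-checked here

* §1 **the CONVERSE of the route's item `JointLowerManin`, at EVERY odd prime**
  (`indexLowerBoundLeAt_of_jointLowerBoundAt`, `indexLowerBoundLeAt_iff_jointLowerBoundAt`): under the
  Heegner/twist data of the door (`W` globally minimal, `r_an = 1`, `K` Heegner for `N_E` with odd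
  `d_K` and `p ∤ #𝓞_K^×`, `L(E^{d_K},1) ≠ 0`, ANY parametrisation datum `Dt`, its traced Heegner point
  `P`, ANY globally minimal model `Wd` of the twist) and the printed facts GZ, KO, GZK, MOD, GZ73,
  STEP L over `K` at slack `v_p(c)` (`IndexLowerBoundLeAt W p K P (v_p Dt.c)`, i.e.
  `2·ord_p[E(K):ℤP] ≤ ord_p #Ш(E/K) + 2·ord_p ∏c_ℓ(E) + 2·v_p(c)`) is EQUIVALENT to the joint lower
  half `JointLowerBoundAt W Wd p` (`ord_p #Ш_an(E) + ord_p #Ш_an(E^{d_K}) ≤ ord_p #Ш(E) + ord_p #Ш(E^{d_K})`).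
  Ingredients: door-c5's Manin-robust identity `exists_shaAn_padicVal_eq_of_heegner_manin`
  (`ord_p q + ord_p q_d + ord_p ∏c_ℓ(E) + 2 ord_p #E^{d_K}(ℚ)_tors + 2 v_p(c) + v_p(u) = 2 ord_p[E(K):ℤP]`),
  door-c5 g3's two EQUALITIES at every odd `p` (`padicValNat_tamagawaProduct_twist_eq_of_heegner_odd`:
  (eq:tamK) with no `p ∤ d_K`; `padicValRat_u_eq_zero_of_twist_minimal_of_heegner_odd`: `v_p(u) = 0`),
  Miller's rank-zero `#Ш_an` (`Wuthrich2014.shaAn_eq_of_L_one_div_eq`) and the uniqueness of the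
  rational value of `#Ш_an`. (door-c5 g0 proved `→` from the two INEQUALITIES; the equalities make it
  an `↔`.)
* §2 **class level, (M) cell.** `stepL_subM_of_lowerHalves`: the printed facts + the LOWER half of
  BSD_p at the rank-one (M) pairs (`MissingLowerBoundAt W p`, = the rung leaf
  `SchneiderFree.AdditiveX3RankOneLower` on its (M) rows) + the tree conjecture `Additive.N10.LowerHalfM`
  (the lower half at the rank-ZERO (M) pairs — VERBATIM the registered stub `stub_rankZero` of crux
  `MultLower`, item 19359 of route `AdditiveBranchIMC`, cell bsd-addord) ⟹ STEP L Manin-robust on every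
  (M) pair (`AdditiveStepLInputManinAt W p`), by §1 + `Typed.joint_of_lower_of_lower` + the Heegner-twist
  transports (`classX3_twist_of_heegner`, `j`-invariance of (M)); hence
  `potMultBranchIMC_of_control_of_leaf_of_lowerHalfM`: printed facts + `AnticycControlAdditiveK` +
  the leaf + `N10.LowerHalfM` ⟹ `PotMultBranchIMC` BY NAME (g2's
  `potMultBranchIMC_of_kolyvagin_of_control_of_stepL_subM`). Conversely (§3,
  `missingLowerBoundAt_subM_of_printedFacts_of_cruxes`) the door restricted to (M) needs only r2 and
  r4: `PrintedFacts + PotMultBranchIMC + AnticycControlAdditiveK ⟹` the leaf on the (M) rows.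

Net (tribunal «C versus S», kernel form): modulo `PrintedFacts` and the control crux r4, the crux r2
`PotMultBranchIMC` implies the rung leaf on (M) and is implied by «leaf on (M) ∧ `N10.LowerHalfM`»;
it carries NO strength beyond the rank-zero partner's lower half (the addord cell's object).

References: Jetchev–Skinner–Wan, Camb. J. Math. 5 (2017) §7.3.1 (eq:tamK), §7.4.1 (eq:gz for K′),
(eq:shalowerK-1) (arXiv:1512.06894 pp. 29–31); Gross–Zagier 1986 Thms. I.(6.3), I.(7.3), V.§2;
Miller, LMS J. Comput. Math. 14 (2011) Def. 1.1; Gross 1991 Thm. 1.3 (Kolyvagin).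
-/

noncomputable section

open scoped Classical

open WeierstrassCurve NumberField IsDedekindDomain Field
  Literature.NumberTheory.EllipticCurves
  Literature.NumberTheory.EllipticCurves.ModularForms
  Literature.NumberTheory.EllipticCurves.GreenbergSelmer
  Literature.NumberTheory.EllipticCurves.Rank1Residual
  Literature.NumberTheory.EllipticCurves.Rank1Residual.Typed
  Summit.BirchSwinnertonDyer.Rank1Residual
  Summit.BirchSwinnertonDyer.Rank1Residual.X11b
  Summit.BirchSwinnertonDyer.Rank1Residual.X11b.AcSelmer
  Summit.BirchSwinnertonDyer.Rank1Residual.X11b.Halves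
  Summit.BirchSwinnertonDyer.BirchSwinnertonDyer.Theses.SchneiderFreeAdditiveX3

-- D-0017 layout: summit = sub-problem, so `Summit.BirchSwinnertonDyer.BirchSwinnertonDyer.…` is the
-- mandated namespace (same option as the route's sockets files).
set_option linter.dupNamespace false
set_option autoImplicit false

namespace Summit.BirchSwinnertonDyer.BirchSwinnertonDyer.Theorems.SchneiderFree

/-! ## §1 The converse of `JointLowerManin`: joint lower half ⟹ STEP L over `K`, every odd `p` -/

section Pointwise

variable (W : WeierstrassCurve ℚ) [W.IsElliptic] [W.IsGloballyMinimal] (p : ℕ) [Fact p.Prime]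
  (N : ℕ) [NeZero N] (K : Type) [Field K] [NumberField K]
  (Dt : ModularParametrizationData W N) (H : HeegnerDatum N (NumberField.discr K)) (ι : K →+* ℂ)
  (P : (W.baseChange K).toAffine.Point)

/-- **Joint lower half ⟹ STEP L over `K` at slack `v_p(c)`, every odd `p`** (the CONVERSE of the
route's item `JointLowerManin`). Data: `W/ℚ` globally minimal with `r_an = 1`, `K` imaginary quadratic
with odd `d_K`, `p ∤ #𝓞_K^×`, the Heegner hypothesis for `N = N_E` and `L(E^{d_K},1) ≠ 0`, ANY
parametrisation datum `Dt` with traced Heegner point `P`, ANY globally minimal model `Wd` of the twist;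
printed inputs GZ, KO, GZK, MOD, GZ73 as binders. If `ord_p #Ш_an(E) + ord_p #Ш_an(E^{d_K}) ≤
ord_p #Ш(E) + ord_p #Ш(E^{d_K})` (`JointLowerBoundAt W Wd p`) then
`2·ord_p[E(K):ℤP] ≤ ord_p #Ш(E/K) + 2·ord_p ∏c_ℓ(E) + 2·v_p(c)` (`IndexLowerBoundLeAt W p K P (v_p c)`).
Proof: the Manin-robust Gross–Zagier identity (door-c5) with (eq:tamK) and `v_p(u) = 0` as EQUALITIES
at every odd `p` (door-c5 g3), Miller's `#Ш_an(E^{d_K}) = q_d·#E^{d_K}(ℚ)²/∏c_ℓ(E^{d_K})`, the `Ш`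
descent `ord_p #Ш(E/K) = ord_p #Ш(E) + ord_p #Ш(E^{d_K})`, and uniqueness of the rational values.
[cite: JetchevSkinnerWan2017, §7.4.1 (eq:gz for K′)–(eq:shalowerK-1) and §7.3.1 (eq:tamK), pp. 29–31]
[cite: GrossZagier1986, Thm. I.(7.3) 2) (p. 231)] [cite: Miller2011LMS, Def. 1.1] -/
theorem indexLowerBoundLeAt_of_jointLowerBoundAt
    (hGZ : gross_zagier N W K) (hKo : kolyvagin N W K)
    (hGZK : rank_eq_analyticRank_of_analyticRank_le_one) (hmod : hasEntireLFunction_rat)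
    (hGZ73 : GrossZagier1986_thm_I_7_3)
    (hr : W.analyticRank = 1) (hN : W.conductorNorm ℤ = N) (hK : IsImaginaryQuadratic K)
    (hodd : Odd (NumberField.discr K)) (hμ : ¬ p ∣ Units.torsionOrder K)
    (hHN : SatisfiesHeegnerHypothesis N K)
    (hLt : (W.quadraticTwist (NumberField.discr K : ℚ)).entireLFunction 1 ≠ 0)
    (hP : WeierstrassCurve.Affine.Point.map ι.toRatAlgHom P = heegnerPointComplex Dt H)
    (Wd : WeierstrassCurve ℚ) [Wd.IsElliptic] [Wd.IsGloballyMinimal]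
    (hC : ∃ C : VariableChange ℚ, C • W.quadraticTwist (NumberField.discr K : ℚ) = Wd) (hp2 : p ≠ 2)
    (hJ : JointLowerBoundAt W Wd p) :
    IndexLowerBoundLeAt W p K P (padicValNat p Dt.c.natAbs) := by
  obtain ⟨Cd, hWd⟩ := hC
  -- the twist's algebraic central value (Gross–Zagier I.(7.3))
  obtain ⟨qd, hqd⟩ := exists_rat_twist_L_one_div_realPeriod_of_heegner W N K Dt H ι P
    hGZ hKo hGZK hmod hGZ73 hK hHN hP hr hLt Wd Cd hWd
  -- the Manin-robust bookkeeping identity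
  obtain ⟨-, -, hsha, q, hq, hval⟩ := exists_shaAn_padicVal_eq_of_heegner_manin W p N K
    Dt H ι P hGZ hKo hGZK hmod hK hHN hP hp2 hμ hr hLt Wd Cd hWd qd hqd
  -- `#Ш_an(E^{d_K})` in rank zero
  have hD0 : (NumberField.discr K : ℚ) ≠ 0 := by exact_mod_cast NumberField.discr_ne_zero K
  haveI : (W.quadraticTwist (NumberField.discr K : ℚ)).IsElliptic := W.isElliptic_quadraticTwist hD0
  have hLd1 : Wd.entireLFunction 1 ≠ 0 := by rw [← hWd, entireLFunction_smul]; exact hLt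
  obtain ⟨-, hfin, -, hshaAnd⟩ := Wuthrich2014.shaAn_eq_of_L_one_div_eq hGZK Wd hLd1 hqd
  haveI := hfin
  have htdeq : Wd.torsionOrder = Nat.card Wd.toAffine.Point := Wd.torsionOrder_eq_natCard_of_finite
  -- the two transports, as EQUALITIES at every odd `p` (door-c5 g3)
  have hHN' : SatisfiesHeegnerHypothesis (W.conductorNorm ℤ) K := by rw [hN]; exact hHN
  have htam := padicValNat_tamagawaProduct_twist_eq_of_heegner_odd W p hp2 K hK hodd hHN' Cd hWd
  have hu := padicValRat_u_eq_zero_of_twist_minimal_of_heegner_odd W p hp2 K hK hodd hHN' Cd hWd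
  -- the joint lower half, with the rational values identified
  obtain ⟨q', qd', hq', hqd', hle⟩ := hJ
  have hqq : q' = q := by
    have : ((q' : ℂ)) = (q : ℂ) := by rw [← hq', hq]
    exact_mod_cast this
  subst hqq
  have hqdqd : qd' = qd * (Nat.card Wd.toAffine.Point : ℚ) ^ 2 / (Wd.tamagawaProduct : ℚ) := by
    have : ((qd' : ℂ)) =
        ((qd * (Nat.card Wd.toAffine.Point : ℚ) ^ 2 / (Wd.tamagawaProduct : ℚ) : ℚ) : ℂ) := by
      rw [← hqd', hshaAnd]
    exact_mod_cast this
  -- valuation of `#Ш_an(E^{d_K})`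
  have hqd0 : qd ≠ 0 := by
    intro h0
    apply hLd1
    have hΩ : (Wd.realPeriodRat : ℂ) ≠ 0 := by exact_mod_cast Wd.realPeriodRat_pos_holds.ne'
    rw [h0, Rat.cast_zero, div_eq_zero_iff] at hqd
    exact hqd.resolve_right hΩ
  have htd0 : (Nat.card Wd.toAffine.Point : ℚ) ≠ 0 := by exact_mod_cast (Nat.card_pos).ne'
  have hcd0 : (Wd.tamagawaProduct : ℚ) ≠ 0 := by exact_mod_cast Wd.tamagawaProduct_pos_holds.ne'
  have hvd : padicValRat p qd' =
      padicValRat p qd + 2 * padicValNat p Wd.torsionOrder - padicValNat p Wd.tamagawaProduct := by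
    rw [hqdqd, padicValRat.div (mul_ne_zero hqd0 (pow_ne_zero _ htd0)) hcd0,
      padicValRat.mul hqd0 (pow_ne_zero _ htd0), padicValRat.pow, padicValRat.of_nat, padicValRat.of_nat,
      htdeq]
    push_cast; ring
  -- STEP L at slack `v_p(c)` from the identity
  unfold IndexLowerBoundLeAt
  have e2 : (padicValNat p (W.baseChange K).shaOrder : ℤ) =
      padicValNat p W.shaOrder + padicValNat p Wd.shaOrder := by exact_mod_cast hsha
  have e3 : (padicValNat p Wd.tamagawaProduct : ℤ) = padicValNat p W.tamagawaProduct := by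
    exact_mod_cast htam
  have e4 : (2 * padicValNat p (AddSubgroup.zmultiples P).index : ℤ) ≤
      padicValNat p (W.baseChange K).shaOrder + 2 * padicValNat p W.tamagawaProduct +
        2 * padicValNat p Dt.c.natAbs := by
    rw [hvd] at hle
    linarith
  exact_mod_cast e4

/-- **STEP L over `K` at slack `v_p(c)` ⟺ the joint lower half, every odd `p`** (under the door's
Heegner/twist data and the printed facts): `→` is the route's PROVED item `JointLowerManin`
(`schneiderFreeAdditiveX3_jointLowerManin_proof`, door-c5; its idle antecedents Cassels `hCas` and the
parametrisation-datum fact `hmodD` are passed through as binders), `←` is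
`indexLowerBoundLeAt_of_jointLowerBoundAt`. CONDITIONAL on the displayed hypotheses; nothing asserted.
[cite: JetchevSkinnerWan2017, §7.4.1 (arXiv:1512.06894 pp. 29–31)] [cite: Miller2011LMS, Def. 1.1] -/
theorem indexLowerBoundLeAt_iff_jointLowerBoundAt
    (hGZ : ∀ (N : ℕ) [NeZero N] (W : WeierstrassCurve ℚ) (K : Type) [Field K] [NumberField K],
      gross_zagier N W K)
    (hKo : ∀ (N : ℕ) [NeZero N] (W : WeierstrassCurve ℚ) (K : Type) [Field K] [NumberField K],
      kolyvagin N W K)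
    (hGZK : rank_eq_analyticRank_of_analyticRank_le_one) (hmod : hasEntireLFunction_rat)
    (hmodD : nonempty_modularParametrizationData) (hCas : WeierstrassCurve.bsdRHS_eq_of_isIsogenous)
    (hGZ73 : GrossZagier1986_thm_I_7_3)
    (hr : W.analyticRank = 1) (hN : W.conductorNorm ℤ = N) (hK : IsImaginaryQuadratic K)
    (hodd : Odd (NumberField.discr K)) (hμ : ¬ p ∣ Units.torsionOrder K)
    (hHN : SatisfiesHeegnerHypothesis N K)
    (hLt : (W.quadraticTwist (NumberField.discr K : ℚ)).entireLFunction 1 ≠ 0)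
    (hP : WeierstrassCurve.Affine.Point.map ι.toRatAlgHom P = heegnerPointComplex Dt H)
    (hnt : ¬ IsOfFinAddOrder P)
    (Wd : WeierstrassCurve ℚ) [Wd.IsElliptic] [Wd.IsGloballyMinimal]
    (hC : ∃ C : VariableChange ℚ, C • W.quadraticTwist (NumberField.discr K : ℚ) = Wd)
    (hrd : Wd.analyticRank = 0) (hp2 : p ≠ 2) :
    IndexLowerBoundLeAt W p K P (padicValNat p Dt.c.natAbs) ↔ JointLowerBoundAt W Wd p :=
  ⟨fun hI ↦ schneiderFreeAdditiveX3_jointLowerManin_proof hGZ hKo hGZK hmod hmodD hCas hGZ73 W p N K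
      Dt H ι P Wd hr hN hK hodd hμ hHN hLt hP hnt hC hrd hp2 hI,
    fun hJ ↦ indexLowerBoundLeAt_of_jointLowerBoundAt W p N K Dt H ι P (hGZ N W K) (hKo N W K) hGZK
      hmod hGZ73 hr hN hK hodd hμ hHN hLt hP Wd hC hp2 hJ⟩

end Pointwise

/-! ## §2 Class level on the (M) cell: leaf on (M) + the partner's rank-zero lower half ⟹ STEP L ⟹ r2 -/

/-- **(M) transports along the Heegner twist** (`j`-invariance: `PotMult W p := ord_p j < 0` and
`j(Wd) = j(W)` for any model of a quadratic twist). [cite: SilvermanAEC2009, X.5 Cor. 5.4] -/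
theorem subM_twist_of_quadratic (W : WeierstrassCurve ℚ) [W.IsElliptic] (p : ℕ) [Fact p.Prime]
    {d : ℚ} (hd : d ≠ 0) {Wd : WeierstrassCurve ℚ} [Wd.IsElliptic]
    (hWd : ∃ C : VariableChange ℚ, C • W.quadraticTwist d = Wd) (hM : Additive.SubM W p) :
    Additive.SubM Wd p := by
  unfold Additive.SubM Additive.PotMult at hM ⊢
  rw [AdditivePotMult.j_of_model_twist hd hWd]
  exact hM

/-- **STEP L (Manin-robust) on the (M) cell from the two LOWER halves.** Printed inputs GZ, KO, GZK,
MOD, GZ73 (binders) + the lower half of BSD_p at every rank-ONE reducible potentially multiplicative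
pair (`MissingLowerBoundAt W p` on `r_an = 1 ∧ p ≠ 2 ∧ ClassX3 ∧ SubM` — the rung leaf
`SchneiderFree.AdditiveX3RankOneLower` on its (M) rows) + the tree conjecture `Additive.N10.LowerHalfM`
(the lower half at every rank-ZERO pair of N10's cell (M); VERBATIM the registered stub `stub_rankZero`
of crux `MultLower`, route `AdditiveBranchIMC`) ⟹ `AdditiveStepLInputManinAt W p` at every (M) pair:
for each Heegner datum take a globally minimal model `Wd` of `E^{d_K}` (`hasGlobalMinimalModel_rat`),
which has `r_an = 0` (`L(E^{d_K},1) ≠ 0`), reducible `Wd[p]` and additive `p` (`classX3_twist_of_heegner`)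
and is potentially multiplicative (`j`-invariance); the two lower halves give the joint one
(`Typed.joint_of_lower_of_lower`) and §1 gives STEP L. CONDITIONAL; nothing asserted.
[cite: JetchevSkinnerWan2017, §7.4.1 (arXiv:1512.06894 pp. 29–31)] [cite: Miller2011LMS, Def. 1.1] -/
theorem stepL_subM_of_lowerHalves
    (hGZ : ∀ (N : ℕ) [NeZero N] (W : WeierstrassCurve ℚ) (K : Type) [Field K] [NumberField K],
      gross_zagier N W K)
    (hKo : ∀ (N : ℕ) [NeZero N] (W : WeierstrassCurve ℚ) (K : Type) [Field K] [NumberField K],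
      kolyvagin N W K)
    (hGZK : rank_eq_analyticRank_of_analyticRank_le_one) (hmod : hasEntireLFunction_rat)
    (hGZ73 : GrossZagier1986_thm_I_7_3)
    (hLow1 : ∀ (W : WeierstrassCurve ℚ) [W.IsElliptic] [W.IsGloballyMinimal] (p : ℕ) [Fact p.Prime],
      W.analyticRank = 1 → p ≠ 2 → ClassX3 W p → Additive.SubM W p → MissingLowerBoundAt W p)
    (hLow0 : Additive.N10.LowerHalfM) :
    ∀ (W : WeierstrassCurve ℚ) [W.IsElliptic] [W.IsGloballyMinimal] (p : ℕ) [Fact p.Prime],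
      W.analyticRank = 1 → p ≠ 2 → ClassX3 W p → Additive.SubM W p →
        AdditiveStepLInputManinAt W p := by
  intro W _ _ p _ hr hp2 hX hM N _ K _ _ Dt H ι P hr' _hloc hN hK hodd hunit hHe hLt hP _hnt
  -- a globally minimal model of the twist, of analytic rank zero, on the rank-zero (M) cell
  have hD0 : (NumberField.discr K : ℚ) ≠ 0 := by exact_mod_cast NumberField.discr_ne_zero K
  haveI hEt : (W.quadraticTwist (NumberField.discr K : ℚ)).IsElliptic :=
    W.isElliptic_quadraticTwist hD0
  obtain ⟨Cd, hCd⟩ := hasGlobalMinimalModel_rat_holds (W.quadraticTwist (NumberField.discr K : ℚ))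
  set Wd : WeierstrassCurve ℚ := Cd • W.quadraticTwist (NumberField.discr K : ℚ) with hWd_def
  haveI : Wd.IsGloballyMinimal := hCd
  have hWd : Cd • W.quadraticTwist (NumberField.discr K : ℚ) = Wd := rfl
  have hrt : (W.quadraticTwist (NumberField.discr K : ℚ)).analyticRank = 0 :=
    ((W.quadraticTwist _).analyticRank_eq_zero_iff_holds (hmod _)).2 hLt
  have hrd : Wd.analyticRank = 0 := by rw [← hWd, analyticRank_smul, hrt]
  have hHN' : SatisfiesHeegnerHypothesis (W.conductorNorm ℤ) K := by rw [hN]; exact hHe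
  have hXd : ClassX3 Wd p := classX3_twist_of_heegner p W K hK hHN' hX Cd hWd
  have hMd : Additive.SubM Wd p := subM_twist_of_quadratic W p hD0 ⟨Cd, hWd⟩ hM
  have hcellM : Additive.N10.CellM Wd p := ⟨hp2, hXd.2, hMd⟩
  -- the two lower halves give the joint one
  have hJ : JointLowerBoundAt W Wd p :=
    joint_of_lower_of_lower (hLow1 W p hr hp2 hX hM) (hLow0 Wd p hrd hcellM)
  -- and §1 gives STEP L over `K` at slack `v_p(c)`
  exact indexLowerBoundLeAt_of_jointLowerBoundAt W p N K Dt H ι P (hGZ N W K) (hKo N W K) hGZK hmod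
    hGZ73 hr hN hK hodd hunit hHe hLt hP Wd ⟨Cd, hWd⟩ hp2 hJ

/-- **`PotMultBranchIMC` (BY NAME) ⇐ printed facts + control + the two lower halves on (M).** GZ, KO,
GZK, MOD, GZ73 (binders) + the repaired control crux `AnticycControlAdditiveK` (item 19295) + the
lower half at the rank-one (M) pairs + `Additive.N10.LowerHalfM` ⟹ the crux r2: §2's
`stepL_subM_of_lowerHalves` composed with door-c2 g2's `potMultBranchIMC_of_kolyvagin_of_control_of_stepL_subM`.
CONDITIONAL on all hypotheses (two of them open conjectures); closes nothing; BSD is not proved by any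
of this. [cite: JetchevSkinnerWan2017, §7.4.1 (arXiv:1512.06894 p. 30)] [cite: Gross1991, Thm. 1.3] -/
theorem potMultBranchIMC_of_control_of_lowerHalves
    (hGZ : ∀ (N : ℕ) [NeZero N] (W : WeierstrassCurve ℚ) (K : Type) [Field K] [NumberField K],
      gross_zagier N W K)
    (hKo : ∀ (N : ℕ) [NeZero N] (W : WeierstrassCurve ℚ) (K : Type) [Field K] [NumberField K],
      kolyvagin N W K)
    (hGZK : rank_eq_analyticRank_of_analyticRank_le_one) (hmod : hasEntireLFunction_rat)
    (hGZ73 : GrossZagier1986_thm_I_7_3)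
    (h4 : AnticycControlAdditiveK)
    (hLow1 : ∀ (W : WeierstrassCurve ℚ) [W.IsElliptic] [W.IsGloballyMinimal] (p : ℕ) [Fact p.Prime],
      W.analyticRank = 1 → p ≠ 2 → ClassX3 W p → Additive.SubM W p → MissingLowerBoundAt W p)
    (hLow0 : Additive.N10.LowerHalfM) :
    PotMultBranchIMC :=
  potMultBranchIMC_of_kolyvagin_of_control_of_stepL_subM hKo (h4 hKo)
    (stepL_subM_of_lowerHalves hGZ hKo hGZK hmod hGZ73 hLow1 hLow0)

/-- **Strength placement of crux r2, upper end**: printed facts (GZ, KO, GZK, MOD, GZ73) + the control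
crux `AnticycControlAdditiveK` + the route's OWN rung leaf `SchneiderFree.AdditiveX3RankOneLower`
(its (M) rows) + the tree conjecture `Additive.N10.LowerHalfM` (rank-zero (M) partners; = bsd-addord's
registered `stub_rankZero` of crux `MultLower`) ⟹ `PotMultBranchIMC`. So, modulo control and print,
the (M) crux carries NO strength beyond «leaf on (M) ∧ partner's rank-zero lower half». CONDITIONAL;
closes nothing. [cite: JetchevSkinnerWan2017, §7.4.1 (arXiv:1512.06894 p. 30)] [cite: Miller2011LMS, Def. 1.1] -/
theorem potMultBranchIMC_of_control_of_leaf_of_lowerHalfM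
    (hGZ : ∀ (N : ℕ) [NeZero N] (W : WeierstrassCurve ℚ) (K : Type) [Field K] [NumberField K],
      gross_zagier N W K)
    (hKo : ∀ (N : ℕ) [NeZero N] (W : WeierstrassCurve ℚ) (K : Type) [Field K] [NumberField K],
      kolyvagin N W K)
    (hGZK : rank_eq_analyticRank_of_analyticRank_le_one) (hmod : hasEntireLFunction_rat)
    (hGZ73 : GrossZagier1986_thm_I_7_3)
    (h4 : AnticycControlAdditiveK) (hLeaf : AdditiveX3RankOneLower) (hLow0 : Additive.N10.LowerHalfM) :
    PotMultBranchIMC :=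
  potMultBranchIMC_of_control_of_lowerHalves hGZ hKo hGZK hmod hGZ73 h4
    (fun W _ _ p _ hr hp2 hX hM ↦ hLeaf W p hr hp2 hX (Or.inl hM)) hLow0

/-- The same with the route's `PrintedFacts` conjunction (item 19184) in place of the five facts.
CONDITIONAL; closes nothing. [cite: JetchevSkinnerWan2017, §7.4.1 (arXiv:1512.06894 p. 30)] -/
theorem potMultBranchIMC_of_printedFacts_of_control_of_leaf_of_lowerHalfM (hF : PrintedFacts)
    (h4 : AnticycControlAdditiveK) (hLeaf : AdditiveX3RankOneLower) (hLow0 : Additive.N10.LowerHalfM) :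
    PotMultBranchIMC :=
  potMultBranchIMC_of_control_of_leaf_of_lowerHalfM hF.1 hF.2.1 hF.2.2.1 hF.2.2.2.1
    hF.2.2.2.2.2.2.1 h4 hLeaf hLow0

/-! ## §3 The lower end: the door restricted to (M) needs only r2 and r4 -/

/-- **The rung leaf on the (M) rows from `PrintedFacts`, r2 and r4 alone** (no `GordTwoBranchIMC`):
`PrintedFacts + PotMultBranchIMC + AnticycControlAdditiveK ⟹ MissingLowerBoundAt W p` at every
rank-one reducible potentially multiplicative pair — the route's `closes` run on `SubM` with STEP L
from door-c2 g0's `additiveStepLInputManinAt_of_kolyvagin_of_potMult_of_control` and the three PROVED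
bookkeeping items (`HeegnerTwistData`, `JointLowerManin`, `PartnerUpperRankZero`). Together with §2:
modulo `PrintedFacts` and r4, `PotMultBranchIMC` sits between «leaf on (M)» and «leaf on (M) ∧
`N10.LowerHalfM`». CONDITIONAL; closes nothing; BSD is not proved by any of this.
[cite: JetchevSkinnerWan2017, §7.4.1 (arXiv:1512.06894 p. 30)] [cite: Miller2011LMS, Def. 1.1] -/
theorem missingLowerBoundAt_subM_of_printedFacts_of_cruxes (hF : PrintedFacts) (h2 : PotMultBranchIMC)
    (h4 : AnticycControlAdditiveK) :
    ∀ (W : WeierstrassCurve ℚ) [W.IsElliptic] [W.IsGloballyMinimal] (p : ℕ) [Fact p.Prime],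
      W.analyticRank = 1 → p ≠ 2 → ClassX3 W p → Additive.SubM W p → MissingLowerBoundAt W p := by
  obtain ⟨hGZ, hKo, hGZK, hmod, hmodD, hCas, hGZ73, hFH, hpar, hHP, hDel, hW16, hWu⟩ := hF
  intro W _ _ p _ hr hp2 hX hM
  have hS : Additive.SubSemistableTwist W p := Or.inl hM
  have hstep : AdditiveStepLInputManinAt W p :=
    additiveStepLInputManinAt_of_kolyvagin_of_potMult_of_control hKo h2 (h4 hKo) W p hr hp2 hX hM
  have hdata : HeegnerTwistDataManinAt W p :=
    schneiderFreeAdditiveX3_heegnerTwistData_proof hFH hpar hHP hGZ hmod hmodD W p hr hp2 hX hS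
  obtain ⟨N, _, K, _, _, Dt, H, ι, P, Wd, _, _, hN, hKiq, hodd, hunit, hHe, hLtw, hP, hnt, hWd,
    hrd, hXd, hSd⟩ := hdata
  have hloc : Additive.N10.Locus W p :=
    (Additive.N10.locus_iff_cells W p).mpr (Or.inl ⟨hp2, hX.2, hM⟩)
  have hidx : IndexLowerBoundLeAt W p K P (padicValNat p Dt.c.natAbs) :=
    hstep N K Dt H ι P hr hloc hN hKiq hodd hunit hHe hLtw hP hnt
  have hJ' : JointLowerBoundAt W Wd p :=
    schneiderFreeAdditiveX3_jointLowerManin_proof hGZ hKo hGZK hmod hmodD hCas hGZ73 W p N K Dt H ι P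
      Wd hr hN hKiq hodd hunit hHe hLtw hP hnt hWd hrd hp2 hidx
  exact missingLowerBoundAt_of_joint_of_upper hJ'
    (schneiderFreeAdditiveX3_partnerUpperRankZero_proof hDel hGZK hmod hmodD hW16 hWu Wd p hrd hp2
      hXd hSd)

end Summit.BirchSwinnertonDyer.BirchSwinnertonDyer.Theorems.SchneiderFree

end
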